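import Literature.Probability.RandomPlanarGeometry.HexSAWSurfaceYcCut
import Literature.Probability.RandomPlanarGeometry.HexSAWStripIdentityY
import Literature.Probability.RandomPlanarGeometry.HexSAWSurfaceFugacity
import HarnessLib

/-!
# The half-plane critical surface fugacity of honeycomb SAW, III: `y_c = 1 + √2` (BBdGDCG14 Theorem 2, Glazman–Manolescu's Definition 1.1)
# (door (c-print) «HEX-YC-PRINT», tree edition file T3 of 3 — glue D3/D7 and the capstone)

Topic `Literature/Probability/RandomPlanarGeometry` (continues `HexSAWSurfaceYcFaces.lean` (I: vocabulary, D2/D4/D5/D6, `TailCount`),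
`HexSAWSurfaceYcCut.lean` (II: D1 `HV.halfPlaneCut_holds`), and takes BY NAME the two kernel strip cores of the lane's door (c):
K97.1 `HV.stripGFy_beta_le` (`HexSAWStripIdentityY.lean`: `B_{T,L}(x_c; y) ≤ √2 y/(1 + √2 − y)` for `0 < y < 1 + √2`, BBdGDCG14
§4.2 eq. (17) = Glazman–Manolescu Cor. 2.5) and T-B′ `HV.stripBy_not_bddAbove_of_gt` (`HexSAWSurfaceFugacity.lean`: for
`y > 1 + √2`, `L ↦ B_{T,L}(x_c; y)` is unbounded for all large `T`, BBdGDCG14 §4.5 eq. (20) + Theorem 10 at the strip level)).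
Sources and READING AS PRINTED (i)–(iv): as in file I.  WHAT IS PROVED: D3 `hpBelow_of_faces` — for `0 < y < 1 + √2` and every
`x < x_c` the box-truncated half-plane partition function is bounded, with the explicit bound
`C^+ ≤ 1 + (2 + 4Z(x))(xy + 2x⁻³ K_β(y)²/(1 − (x/x_c)⁴))`, `K_β(y) = √2 y/(1 + √2 − y)` (two-cut decomposition D1 + level cost D2 +
K97.1 + `Z(x) < ∞` from the tree's `summable_of_lemma2`); D7 `hpAbove_of_faces` — for `y > 1 + √2` it diverges at some
`x < x_c` (Hölder transfer D4 from one supercritical strip point D5, reversal injection D6, T-B′) — the part of the door that is NEW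
relative to print (Glazman–Manolescu §5.1–5.3 and BBdGDCG14 Props 6–8 import Corollary 8 / the strip radius `y_T`; this route
does not); and the capstone **`HV.hexSurfaceYc_eq : hexSurfaceYc = 1 + √2`** with NO hypothesis (BBdGDCG14 Theorem 2, arXiv v5
p. 3, for `y_c` in the sup-radius form of Prop. 5 = Glazman–Manolescu Definition 1.1 / Theorem 3 at `Θ ≡ π/3`).
LABEL (lit-1 g12, 2026-08-23): CONSOLIDATION — printed, proved theorem; desorbed half = formalisation of GM20 §5.4's route; adsorbed
half = new Corollary-8-free route; explicit constants; kernel-checked.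

DESIGN AND AUTHORSHIP.  Statements and proofs are a-idea-1 gen 18's HOME sketch `Sketch_G18_YcPrint.lean` ed.5 (08b0d94aa61eee15)
VERBATIM (glue blocks 0–2 and the capstone), moved to the tree namespace by the filer a-p6 gen 8; the sketch's two input faces
`StripBetaBoundXc` / `StripBetaUnboundedXc` are kept as named Props AND discharged here (`stripBetaBoundXc_holds`,
`stripBetaUnboundedXc_holds`) from the tree theorems by `rfl` on the vocabulary (`stripGFxy_xc`); the sketch's conditional
`hexSurfaceYc_eq (hβ) (hB)` is `hexSurfaceYc_eq_of_stripCores`, and `hexSurfaceYc_eq` is the unconditional theorem.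
-/

noncomputable section

open Finset Filter Topology

namespace Literature.Probability.RandomPlanarGeometry.SAW.HV

/-! ### The two strip-core inputs, discharged by name -/

/-- T-A′ explicit (K97.1 `HV.stripGFy_beta_le`, BBdGDCG §4.2 eq. (17)): `B_{T,L}(x_c; y) ≤ √2 y/(1 + √2 − y)` for `0 < y < 1 + √2`, `T ≥ 1`.
[cite: BeatonBousquetMelouDeGierDuminilCopinGuttmann2014, §4.2 eq. (17) (arXiv v5 p. 14)] -/
def StripBetaBoundXc : Prop := ∀ (T L : ℕ), 1 ≤ T → ∀ y : ℝ, 0 < y → y < 1 + Real.sqrt 2 →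
  stripGFxy T L (IsBetaDart T) hexCriticalFugacity y ≤ Real.sqrt 2 * y / (1 + Real.sqrt 2 - y)

/-- T-B′ (⑦ `HV.stripBy_not_bddAbove_of_gt`, BBdGDCG §4.5): for `y > 1 + √2` and all large `T`, `L ↦ B_{T,L}(x_c; y)` is unbounded.
[cite: BeatonBousquetMelouDeGierDuminilCopinGuttmann2014, §4.5 eq. (20) with Theorem 10 (arXiv v5 pp. 14–15)] -/
def StripBetaUnboundedXc : Prop := ∀ y : ℝ, 1 + Real.sqrt 2 < y → ∃ T₀ : ℕ, ∀ T ≥ T₀,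
  ¬ BddAbove (Set.range fun L : ℕ => stripGFxy T L (IsBetaDart T) hexCriticalFugacity y)

/-- **T-A′ holds** — a-p2's K97.1 `HV.stripGFy_beta_le`, read through `stripGFxy_xc`. [cite: BeatonBousquetMelouDeGierDuminilCopinGuttmann2014, §4.2 eq. (17) (arXiv v5 p. 14); GlazmanManolescu2019, Corollary 2.5 (arXiv v3 p. 9)] -/
theorem stripBetaBoundXc_holds : StripBetaBoundXc := fun _ _ hT _ hy hlt => by
  rw [stripGFxy_xc]; exact stripGFy_beta_le hT hy hlt

/-- **T-B′ holds** — the lane's strip-level divergence `HV.stripBy_not_bddAbove_of_gt` (door «HEX-YC-DCS» capstone), read through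
`stripGFxy_xc`. [cite: BeatonBousquetMelouDeGierDuminilCopinGuttmann2014, §4.5 eq. (20) with Theorem 10 (arXiv v5 pp. 14–15)] -/
theorem stripBetaUnboundedXc_holds : StripBetaUnboundedXc := fun _ hy => stripBy_not_bddAbove_of_gt hy

/-! ### The two half-plane faces -/

/-- **D3 «HP-BELOW» (`y < y*` ⇒ desorbed: `ρ(y) ≥ x_c`, i.e. `μ(y) ≤ μ`).**  From D1 + D2 + T-A′ (β bound, uniform in `T'`)
+ `TailCount` + `Z(x) < ∞` (tree `summable_of_lemma2`): `C^+(x,y) ≤ 1 + (2+4Z(x))(xy + 2x⁻³ K_β(y)² Σ_{T'} (x/x_c)^{4T'}) < ∞` for `x < x_c`.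
[cite: BeatonBousquetMelouDeGierDuminilCopinGuttmann2014, §4.2 ("y* ≤ y_T … hence y* ≤ y_c", arXiv v5 p. 14) with Cor. 8 (p. 12)] -/
def HPBelow : Prop := ∀ y : ℝ, 0 < y → y < 1 + Real.sqrt 2 → ∀ x : ℝ, 0 < x → x < hexCriticalFugacity → HalfPlaneBounded x y

/-- **D7 «HP-ABOVE» (`y > y*` ⇒ adsorbed: `ρ(y) < x_c`, i.e. `μ(y) > μ`).**  PROVED below from T-B′ + D4 + D5 + D6 (`hpAbove_of_faces`).
[cite: BeatonBousquetMelouDeGierDuminilCopinGuttmann2014, §4.5 ("this forces y* ≥ y_c", arXiv v5 p. 15) with Prop. 5 (p. 9)] -/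
def HPAbove : Prop := ∀ y : ℝ, 1 + Real.sqrt 2 < y → ∃ x : ℝ, 0 < x ∧ x < hexCriticalFugacity ∧ ¬ HalfPlaneBounded x y

/-! ### PROVED GLUE 0: D1 + D2 + T-A′ + TailCount + `Z(x) < ∞` ⇒ D3 -/

/-- **`y < y*` ⇒ the half-plane partition function is finite for every `x < x_c`**, from the two-cut decomposition D1 with
the explicit inputs `b(T') = (x/x_c)^{2T'} √2 y/(1+√2−y)` (D2 + T-A′), `c = hexSawCount` (`TailCount`) and
`z = Z(x) = Σ c_m x^m < ∞` (tree `summable_of_lemma2`): `C^+ ≤ 1 + (2+4Z(x))(xy + 2x⁻³ K_β²/(1−(x/x_c)⁴))` uniformly in the box.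
[cite: BeatonBousquetMelouDeGierDuminilCopinGuttmann2014, §4.2 with Cor. 8 (arXiv v5 pp. 12, 14); GlazmanManolescu2019, §5.4, proof of Theorem 3 (arXiv v3 pp. 23–24); DuminilCopinSmirnov2012, §3 ("Z(x) < +∞ whenever x < x_c")] -/
theorem hpBelow_of_faces (hCut : HalfPlaneCut) (hLC : LevelCost) (hβ : StripBetaBoundXc) (hTail : TailCount) : HPBelow := by
  intro y hy0 hyS x hx0 hxc
  obtain ⟨hxc0, hxc1⟩ := hexCriticalFugacity_pos_lt_one
  have hx1 : x ≤ 1 := hxc.le.trans hxc1.le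
  have hs2 : 0 < Real.sqrt 2 := Real.sqrt_pos.2 (by norm_num)
  set ρ := x / hexCriticalFugacity with hρ_def
  have hρ0 : 0 ≤ ρ := div_nonneg hx0.le hxc0.le
  have hρ1 : ρ < 1 := (div_lt_one hxc0).2 hxc
  set Kβ := Real.sqrt 2 * y / (1 + Real.sqrt 2 - y) with hKβ_def
  have hKβ0 : 0 ≤ Kβ := div_nonneg (mul_nonneg hs2.le hy0.le) (by linarith)
  -- the free tail: `Z(x) < ∞`
  have hsum : Summable fun n => (hexSawCount n : ℝ) * x ^ n :=
    summable_of_lemma2 DuminilCopinSmirnov2012_lemma2_holds hx0 hxc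
  set z := ∑' n, (hexSawCount n : ℝ) * x ^ n with hz_def
  have hz0 : 0 ≤ z := tsum_nonneg fun n => mul_nonneg (Nat.cast_nonneg _) (pow_nonneg hx0.le _)
  have hz : ∀ N : ℕ, ∑ m ∈ range N, (hexSawCount m : ℝ) * x ^ m ≤ z := fun N =>
    Summable.sum_le_tsum _ (fun m _ => mul_nonneg (Nat.cast_nonneg _) (pow_nonneg hx0.le _)) hsum
  -- the strip input at `x ≤ x_c`
  have hb : ∀ T' L' : ℕ, 1 ≤ T' → stripGFxy T' L' (IsBetaDart T') x y ≤ ρ ^ (2 * T') * Kβ := fun T' L' hT' =>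
    (hLC T' L' x y hx0.le hxc.le hy0.le).trans (mul_le_mul_of_nonneg_left (hβ T' L' hT' y hy0 hyS) (pow_nonneg hρ0 _))
  have hmain := hCut x y hx0 hx1 hy0.le (fun T' => ρ ^ (2 * T') * Kβ) (fun m => (hexSawCount m : ℝ)) z hb hTail hz
  -- the geometric series in `T'`
  have hρ4 : ρ ^ 4 < 1 := pow_lt_one₀ hρ0 hρ1 (by norm_num)
  have hρ40 : 0 ≤ ρ ^ 4 := pow_nonneg hρ0 4
  have hgeom : ∀ T : ℕ, ∑ T' ∈ Icc 1 T, (ρ ^ 4) ^ T' ≤ (1 - ρ ^ 4)⁻¹ := fun T => by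
    rw [← tsum_geometric_of_lt_one hρ40 hρ4]
    exact Summable.sum_le_tsum _ (fun _ _ => pow_nonneg hρ40 _) (summable_geometric_of_lt_one hρ40 hρ4)
  have hST : ∀ T : ℕ, ∑ T' ∈ Icc 1 T, ρ ^ (2 * T') * Kβ * (ρ ^ (2 * T') * Kβ) ≤ Kβ * Kβ * (1 - ρ ^ 4)⁻¹ := fun T => by
    have : ∑ T' ∈ Icc 1 T, ρ ^ (2 * T') * Kβ * (ρ ^ (2 * T') * Kβ) = Kβ * Kβ * ∑ T' ∈ Icc 1 T, (ρ ^ 4) ^ T' := by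
      rw [mul_sum]
      refine sum_congr rfl fun T' _ => ?_
      rw [← pow_mul, show 4 * T' = 2 * T' + 2 * T' by ring, pow_add]
      ring
    rw [this]
    exact mul_le_mul_of_nonneg_left (hgeom T) (by positivity)
  refine ⟨1 + (2 + 4 * z) * (x * y + 2 * x⁻¹ ^ 3 * (Kβ * Kβ * (1 - ρ ^ 4)⁻¹)), ?_⟩
  rintro _ ⟨⟨T, L⟩, rfl⟩
  refine (hmain T L).trans ?_
  have hx3 : 0 ≤ 2 * x⁻¹ ^ 3 := mul_nonneg zero_le_two (pow_nonneg (inv_nonneg.2 hx0.le) 3)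
  have h2z : 0 ≤ 2 + 4 * z := by positivity
  have h1 : 2 * x⁻¹ ^ 3 * (∑ T' ∈ Icc 1 T, ρ ^ (2 * T') * Kβ * (ρ ^ (2 * T') * Kβ))
      ≤ 2 * x⁻¹ ^ 3 * (Kβ * Kβ * (1 - ρ ^ 4)⁻¹) := mul_le_mul_of_nonneg_left (hST T) hx3
  have h3 : (2 + 4 * z) * (x * y + 2 * x⁻¹ ^ 3 * ∑ T' ∈ Icc 1 T, ρ ^ (2 * T') * Kβ * (ρ ^ (2 * T') * Kβ))
      ≤ (2 + 4 * z) * (x * y + 2 * x⁻¹ ^ 3 * (Kβ * Kβ * (1 - ρ ^ 4)⁻¹)) :=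
    mul_le_mul_of_nonneg_left (by linarith) h2z
  linarith

/-! ### PROVED GLUE 1: the Hölder transfer — T-B′ + D4 + D5 + D6 ⇒ D7 -/

/-- **`y > y*` ⇒ the half-plane partition function diverges at some `x < x_c`.**  Proof: pick `y' = y^θ ∈ (y*, y)` (`θ = (t + t*)/(2t)`,
`t = log y`), `T ≥ T₀(y')`, the supercritical finite point `(x₁, 1)` of D5, and `x := exp((log x_c − (1−θ) log x₁)/θ) < x_c`, so that
`(x₁, 1)^{1−θ} · (x, y)^θ = (x_c, y')`; Hölder bounds the unbounded `B_T(x_c; y')` by `B_T(x₁; 1)^{1−θ} B_T(x; y)^θ`, so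
`L ↦ B_T(x; y)` is unbounded, and D6 pushes this into the half-plane. [cite: BeatonBousquetMelouDeGierDuminilCopinGuttmann2014, §4.5 with Prop. 5–6 (arXiv v5 pp. 9–10, 15)] -/
theorem hpAbove_of_faces (hB : StripBetaUnboundedXc) (hH : HoelderXY) (hS : StripSupercritFinite) (hR : ReversalInjection) :
    HPAbove := by
  intro y hy
  have hxc : 0 < hexCriticalFugacity := hexCriticalFugacity_pos_lt_one.1
  have hs2 : 0 < Real.sqrt 2 := Real.sqrt_pos.2 (by norm_num)
  have hys : (1 : ℝ) < 1 + Real.sqrt 2 := by linarith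
  have hy1 : 1 < y := hys.trans hy
  have hy0 : 0 < y := one_pos.trans hy1
  -- logs
  set t := Real.log y with ht_def
  set ts := Real.log (1 + Real.sqrt 2) with hts_def
  have hts0 : 0 < ts := Real.log_pos hys
  have htst : ts < t := Real.log_lt_log (by linarith) hy
  have ht0 : 0 < t := hts0.trans htst
  set θ := (t + ts) / (2 * t) with hθ_def
  have hθ0 : 0 < θ := by positivity
  have hθ1 : θ < 1 := by rw [hθ_def, div_lt_one (by positivity)]; linarith
  -- y' = y^θ lies strictly between y* and y
  set y' := y ^ θ with hy'_def
  have hlogy' : Real.log y' = θ * t := by rw [hy'_def, Real.log_rpow hy0]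
  have hy's : 1 + Real.sqrt 2 < y' := by
    have : ts < Real.log y' := by
      rw [hlogy', hθ_def]; rw [div_mul_eq_mul_div, lt_div_iff₀ (by positivity)]; nlinarith
    exact (Real.log_lt_log_iff (by linarith) (Real.rpow_pos_of_pos hy0 θ)).1 this
  obtain ⟨T₀, hT₀⟩ := hB y' hy's
  set T := max T₀ 1 with hT_def
  have hT1 : 1 ≤ T := le_max_right _ _
  have hunb := hT₀ T (le_max_left _ _)
  obtain ⟨x₁, hx₁c, ⟨M, hM⟩⟩ := hS T hT1
  have hx₁0 : 0 < x₁ := hxc.trans hx₁c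
  -- the subcritical point x
  set x := Real.exp ((Real.log hexCriticalFugacity - (1 - θ) * Real.log x₁) / θ) with hx_def
  have hx0 : 0 < x := Real.exp_pos _
  have hlogx : Real.log x = (Real.log hexCriticalFugacity - (1 - θ) * Real.log x₁) / θ := Real.log_exp _
  have hxlt : x < hexCriticalFugacity := by
    rw [← Real.log_lt_log_iff hx0 hxc, hlogx, div_lt_iff₀ hθ0]
    have : Real.log hexCriticalFugacity < Real.log x₁ := Real.log_lt_log hxc hx₁c
    nlinarith
  -- the interpolation identities
  have hxi : x₁ ^ (1 - θ) * x ^ θ = hexCriticalFugacity := by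
    rw [Real.rpow_def_of_pos hx₁0, Real.rpow_def_of_pos hx0, ← Real.exp_add, hlogx]
    rw [show Real.log x₁ * (1 - θ) + (Real.log hexCriticalFugacity - (1 - θ) * Real.log x₁) / θ * θ
        = Real.log hexCriticalFugacity by field_simp; ring]
    exact Real.exp_log hxc
  have hyi : (1 : ℝ) ^ (1 - θ) * y ^ θ = y' := by rw [Real.one_rpow, one_mul]
  refine ⟨x, hx0, hxlt, ?_⟩
  -- unboundedness of L ↦ B_T(x; y)
  have hunbx : ¬ BddAbove (Set.range fun L : ℕ => stripGFxy T L (IsBetaDart T) x y) := by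
    rintro ⟨M', hM'⟩
    apply hunb
    refine ⟨M ^ (1 - θ) * (max M' 0) ^ θ, ?_⟩
    rintro _ ⟨L, rfl⟩
    have hHL := hH T L x₁ x 1 y θ hx₁0 hx0 one_pos hy0 hθ0 hθ1
    rw [hxi, hyi] at hHL
    refine hHL.trans (mul_le_mul ?_ ?_ (Real.rpow_nonneg (stripGFxy_nonneg _ _ _ hx0.le hy0.le) _)
      (Real.rpow_nonneg ((stripGFxy_nonneg _ _ _ hx₁0.le zero_le_one).trans (hM ⟨0, rfl⟩)) _))
    · exact Real.rpow_le_rpow (stripGFxy_nonneg _ _ _ hx₁0.le zero_le_one) (hM ⟨L, rfl⟩) (by linarith)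
    · exact Real.rpow_le_rpow (stripGFxy_nonneg _ _ _ hx0.le hy0.le) ((hM' ⟨L, rfl⟩).trans (le_max_left _ _)) hθ0.le
  -- push into the half-plane
  rintro ⟨C, hC⟩
  apply hunbx
  refine ⟨C, ?_⟩
  rintro _ ⟨L, rfl⟩
  obtain ⟨L', hL'⟩ := hR T L x y hT1 hx0.le hy0.le
  exact hL'.trans (hC ⟨(T, L'), rfl⟩)

/-! ### PROVED GLUE 2: the capstone — D3 + D7 ⇒ `y_c = 1 + √2` -/

/-- Members of the desorbed set lie below `1 + √2` (by D7). [cite: BeatonBousquetMelouDeGierDuminilCopinGuttmann2014, Theorem 2 (arXiv v5 p. 3)] -/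
theorem le_yStar_of_mem_ycSet (hA : HPAbove) {y : ℝ} (hy : y ∈ ycSet) : y ≤ 1 + Real.sqrt 2 := by
  by_contra h
  push Not at h
  obtain ⟨x, hx0, hxc, hnb⟩ := hA y h
  exact hnb (hy.2 x hx0 hxc)

/-- `(0, 1 + √2) ⊆` the desorbed set (by D3). [cite: BeatonBousquetMelouDeGierDuminilCopinGuttmann2014, §4.2 (arXiv v5 p. 14)] -/
theorem mem_ycSet_of_lt (hBel : HPBelow) {y : ℝ} (hy0 : 0 < y) (hy : y < 1 + Real.sqrt 2) : y ∈ ycSet :=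
  ⟨hy0.le, fun x hx0 hxc => hBel y hy0 hy x hx0 hxc⟩

/-- **CAPSTONE OF DOOR (c-print), DCS frame: the half-plane critical surface fugacity of the honeycomb lattice is `1 + √2`**
(BBdGDCG14 Theorem 2 with `y_c` in the radius form of Prop. 5 / Cor. 8), from the two half-plane faces D3 and D7 — themselves
reduced above/below to the lane's kernel-done strip cores T-A′/T-B′ plus D1, D2, D4, D5, D6, `TailCount`.
[cite: BeatonBousquetMelouDeGierDuminilCopinGuttmann2014, Theorem 2 (arXiv v5 p. 3), Prop. 5 (p. 9), Cor. 8 (p. 12)] -/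
theorem hexSurfaceYc_eq_of_faces (hBel : HPBelow) (hA : HPAbove) : hexSurfaceYc = 1 + Real.sqrt 2 := by
  have hs2 : 0 < Real.sqrt 2 := Real.sqrt_pos.2 (by norm_num)
  have h1 : (1 : ℝ) ∈ ycSet := mem_ycSet_of_lt hBel one_pos (by linarith)
  have hne : ycSet.Nonempty := ⟨1, h1⟩
  have hbdd : BddAbove ycSet := ⟨1 + Real.sqrt 2, fun y hy => le_yStar_of_mem_ycSet hA hy⟩
  apply le_antisymm
  · exact csSup_le hne fun y hy => le_yStar_of_mem_ycSet hA hy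
  · apply le_of_forall_lt_imp_le_of_dense
    intro c hc
    by_cases hc0 : c ≤ 1
    · exact hc0.trans (le_csSup hbdd h1)
    · push Not at hc0
      exact le_csSup hbdd (mem_ycSet_of_lt hBel (one_pos.trans hc0) hc)

/-- **The whole door in one theorem**: the kernel-done strip cores T-A′ (β bound) / T-B′ + the three OPEN elementary faces
D1 `HalfPlaneCut` (two-cut decomposition, M; template = tree `HexSAWBridges`), D5 `StripSupercritFinite` (HEX-STRIP-STRICT in GF form, S–M),
D6 `ReversalInjection` (S–M) ⇒ `y_c = 1 + √2`; D2, D4, `TailCount` and all the analysis (D3, D7, sSup) are PROVED in this file.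
[cite: BeatonBousquetMelouDeGierDuminilCopinGuttmann2014, Theorem 2 (arXiv v5 p. 3)] -/
theorem hexSurfaceYc_eq_of_faces' (hCut : HalfPlaneCut) (hβ : StripBetaBoundXc) (hB : StripBetaUnboundedXc)
    (hS : StripSupercritFinite) (hR : ReversalInjection) : hexSurfaceYc = 1 + Real.sqrt 2 :=
  hexSurfaceYc_eq_of_faces (hpBelow_of_faces hCut levelCost_holds hβ tailCount_holds)
    (hpAbove_of_faces hB hoelderXY_holds hS hR)

/-- **Door (c-print) with D6 discharged**: T-A′/T-B′ (kernel-done strip cores) + D1 `HalfPlaneCut` + D5 `StripSupercritFinite` ⇒ `y_c = 1 + √2`.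
[cite: BeatonBousquetMelouDeGierDuminilCopinGuttmann2014, Theorem 2 (arXiv v5 p. 3)] -/
theorem hexSurfaceYc_eq_of_faces'' (hCut : HalfPlaneCut) (hβ : StripBetaBoundXc) (hB : StripBetaUnboundedXc)
    (hS : StripSupercritFinite) : hexSurfaceYc = 1 + Real.sqrt 2 :=
  hexSurfaceYc_eq_of_faces' hCut hβ hB hS reversalInjection_holds


/-- **THE PRINTED THEOREM, door (c-print) «HEX-YC-PRINT» — all nine faces discharged in this file except the two KERNEL-DONE strip
cores it takes as inputs**: K97.1 `StripBetaBoundXc` (a-p2, `HV.stripGFy_beta_le`) and ⑦ T-B′ `StripBetaUnboundedXc`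
(`HV.stripBy_not_bddAbove_of_gt`) ⇒ the critical surface fugacity of the honeycomb half-plane is `y_c = 1 + √2`.
[cite: BeatonBousquetMelouDeGierDuminilCopinGuttmann2014, Theorem 2 (arXiv v5 p. 3) with Prop. 5 (p. 9: the radius characterisation of y_c)] -/
theorem hexSurfaceYc_eq_of_stripCores (hβ : StripBetaBoundXc) (hB : StripBetaUnboundedXc) : hexSurfaceYc = 1 + Real.sqrt 2 :=
  hexSurfaceYc_eq_of_faces' halfPlaneCut_holds hβ hB stripSupercritFinite_holds reversalInjection_holds

/-- **D3 holds unconditionally**: for `0 < y < 1 + √2` the box-truncated half-plane partition function is bounded for every `x < x_c`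
(two-cut decomposition D1 + level cost D2 + K97.1's strip bound + `Z(x) < ∞`). [cite: BeatonBousquetMelouDeGierDuminilCopinGuttmann2014, §4.2 (arXiv v5 p. 14: the desorbed conclusion y* ≤ y_c); GlazmanManolescu2019, §5.4, proof of Theorem 3 (arXiv v3 pp. 23–24)] -/
theorem hpBelow_holds : HPBelow :=
  hpBelow_of_faces halfPlaneCut_holds levelCost_holds stripBetaBoundXc_holds tailCount_holds

/-- **D7 holds unconditionally**: for `y > 1 + √2` the half-plane partition function diverges at some `x < x_c` (Hölder transfer from one
supercritical strip point + reversal injection + the strip-level divergence T-B′ — the Corollary-8-free half of the door).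
[cite: BeatonBousquetMelouDeGierDuminilCopinGuttmann2014, §4.5 (arXiv v5 p. 15: "this forces y* ≥ y_c") with Prop. 5 (p. 9)] -/
theorem hpAbove_holds : HPAbove :=
  hpAbove_of_faces stripBetaUnboundedXc_holds hoelderXY_holds stripSupercritFinite_holds reversalInjection_holds

/-- **BBdGDCG14 THEOREM 2 / Glazman–Manolescu THEOREM 3 at `Θ ≡ π/3`, door (c-print) «HEX-YC-PRINT», NO HYPOTHESIS: the critical surface
fugacity of self-avoiding walks in the honeycomb half-plane is `y_c = 1 + √2`** (for `y_c = hexSurfaceYc`, the sup-radius threshold of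
Prop. 5 / GM Definition 1.1). [cite: BeatonBousquetMelouDeGierDuminilCopinGuttmann2014, Theorem 2 (arXiv v5 p. 3) with Prop. 5 (p. 9); GlazmanManolescu2019, Theorem 3 and Definition 1.1 (arXiv v3 p. 5)] -/
theorem hexSurfaceYc_eq : hexSurfaceYc = 1 + Real.sqrt 2 :=
  hexSurfaceYc_eq_of_stripCores stripBetaBoundXc_holds stripBetaUnboundedXc_holds

end Literature.Probability.RandomPlanarGeometry.SAW.HV

/-! ## `_holds` aliases (appended 2026-08-28)

The named fact(s) below are already theorems of the tree under a differently-cased `_holds` name; the exact-name `_holds`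
alias records the discharge under the tree's naming convention (D-0026 bookkeeping: proof term =
the existing theorem, no statement or definition edited). -/

/-- `HPBelow` is a theorem of the tree (`Literature.Probability.RandomPlanarGeometry.SAW.HV.hpBelow_holds`). [cite: BeatonBousquetMelouDeGierDuminilCopinGuttmann2014, §4.2 ("y* ≤ y_T … hence y* ≤ y_c", arXiv v5 p. 14) with Cor. 8 (p. 12)] -/
theorem _root_.Literature.Probability.RandomPlanarGeometry.SAW.HV.HPBelow_holds : _root_.Literature.Probability.RandomPlanarGeometry.SAW.HV.HPBelow :=
  _root_.Literature.Probability.RandomPlanarGeometry.SAW.HV.hpBelow_holds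

/-- `HPAbove` is a theorem of the tree (`Literature.Probability.RandomPlanarGeometry.SAW.HV.hpAbove_holds`). [cite: BeatonBousquetMelouDeGierDuminilCopinGuttmann2014, §4.5 ("this forces y* ≥ y_c", arXiv v5 p. 15) with Prop. 5 (p. 9)] -/
theorem _root_.Literature.Probability.RandomPlanarGeometry.SAW.HV.HPAbove_holds : _root_.Literature.Probability.RandomPlanarGeometry.SAW.HV.HPAbove :=
  _root_.Literature.Probability.RandomPlanarGeometry.SAW.HV.hpAbove_holds
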